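/-
Copyright: the b2b-balaban T⁴-continuum CRUX team, row NE7b owner lineage `t4-ne7b-p1` (gen 114). Project licence.
-/
import Summits.QuantumFields.BalabanUV.T4Continuum.Spine.NE7b.OneShotChartSupNorm
import Literature.MathematicalPhysics.QuantumFieldTheory.Balaban1983to89.B5Hk165TranslZd
import Literature.MathematicalPhysics.QuantumFieldTheory.Balaban1983to89.Beta.EntrywiseVolumeLimit

/-!
# THE ONE-SHOT SECTION IS BLOCK-COVARIANT IN EVERY DIMENSION, AND ON PERIODIC COARSE DATA IT *IS* THE PERIODISED TORUS
# MATRIX: for the scalar `H = G′Q′*(Q′G′Q′*)⁻¹` of [B5] (1.103) on `ℤ^d` (block side `n + 1`, `a > 0`, EVERY `d`):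
# `G′(p + (n+1)t, q + (n+1)t) = G′(p, q)` (here), `H(p + (n+1)t, y + t) = H(p, y)` (Literature `B5Hk165TranslZd`, every `d`);
# `(H B)(p)` commutes with coarse translations; for every coarse torus period `s` and every `B : (ℤ∕s)^d → ℝ`,
# `(H (B ∘ siteOf))(p) = Σ_{c ∈ (ℤ∕s)^d} Ĥ(p, c)·B(c)` with `Ĥ(p, c) := Σ′_m H(p, ĉ + s·m)`, `Σ_c Ĥ(p, c) = 1`,
# `Σ_c |Ĥ(p, c)| ≤ Σ′_y |H(p, y)|` (≤ `C_∞(d,a)` for `d ≥ 3`, ≤ some `C(d,a)` for every `d`), and the output is periodic in the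
# fine variable with the fine torus period `(n+1)·s` — (54) `…OneShotChartTorusRows` FOR EVERY DIMENSION plus the operator-level
# identity (row NE7b, node U5c; (CT-4) every `d`; `B5Hk165TranslZd.kerH_translate` (pv23, every `d`),
# `B4Sect5Exhaustion.eq_limInv_of_left_inverse`, `Beta.VolumeConvolution.tsum_eq_sum_tsum_imageShift`, (46) v1.1 BY NAME; [folklore])

Cell `pub-balaban`, sub-cell `t4`, spine estimate NE7b (`T4WeightBudget.RelWeightBound`; the cell's OWN estimate — NOT PRINTED
in [Bałaban 1983–89], NOT PROVED).  Crux-route work under `Spine/NE7b/` by the row OWNER (`t4-ne7b-p1` gen 114) under FREEZE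
(0)'s crux-prover clause (FILING-CLAIM C-ne7bp1-g114-1); NOTHING of Bałaban's is asserted; no `T4Continuum/Support` leaf typed; no
`def` (the periodised row is written out as the image series); zero `sorry`.  Imports (BY NAME): (46) `…OneShotChartSupNorm`
(`summable_abs_kerH_row`, `tsum_abs_kerH_le_sup` for `d ≥ 3`, v1.1's `exists_tsum_abs_kerH_le_all` for every `d`,
`summable_HBZd_of_bounded`), the Literature module `B5Hk165TranslZd` (pv23 g7: **`kerH_translate` and `Kinv_translate` FOR EVERY
`d`** by node-6 uniqueness `col_eq_kerH` — located by this gen's dry-run dedup; `bshift`, `sum_B_add`, `lapKer_add_right`), the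
Literature periodisation kit `Beta/EntrywiseVolumeLimit` ⊇ `Beta/VolumeConvolution` ⊇
`Beta/VolumeImages` ⊇ `Beta/InfiniteVolume` (`tsum_eq_sum_tsum_imageShift`, `imageShift`, `imageShift_injective`, `imageShift_add`,
`windowMap`, `siteOf`, `siteOf_imageShift`, `siteOf_windowMap`), and through them `B5Hk103ScalarZd` (`Gk`, `gq`, `Kinv`, `kerH`,
`toK`, `abs_Gk_le`, `tsum_Gk_mul_AX`, `tsum_kerH_row`), `B5Hk165L2Zd` (`HBZd`), `B6QGQLower276` ∕ `B6QGQDecay237` (the site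
matrix `AX`, blocks `B`, `blk`, `side`, `kerQGQ`, the (5.6)-hypothesis `hyp56Z_Aker` and its constants), `B4Sect5Exhaustion`
(`eq_limInv_of_left_inverse`).

WHY (located).  (54) typed the block covariance of `H` and the torus rows at `d = 4` only, because it borrowed the β-team's
`GhostLeg.Gk_translate` ∕ `RJetProjector.gq_translate`, typed on `ℤ⁴`; the owner's HANDOFF § [NE7bP1-G113-HANDOFF] «NEXT (6)(ii)»
asks for every `d` («the proof is dimension-free, only GhostLeg's typing is d = 4»), matching (46) v1.1's every-dimension sup
letters.  LOCATED (this gen's dry-run): the Literature ALREADY holds `kerH_translate` ∕ `Kinv_translate` for every `d`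
(`B5Hk165TranslZd`, pv23, in the `bshift n z = (n+1)•z` spelling, by the weak-Euler–Lagrange uniqueness of node 6) — §1 IMPORTS
them (`kerH_translate_side` is the one-line respelling with `side n • t`) and adds only what is not there: the block covariance of
`G′`, `G′Q′*`, `Q′G′Q′*` and of the site matrix in every `d` (leaf-06's `…OneShotChartReflection` (OSCRF, p391413) ran the
uniqueness-of-the-bounded-inverse argument for an axis REFLECTION in every `d`; §1 runs it for block-lattice TRANSLATIONS), and the
operator form `HBZd_translate`.  §2 lifts (54) §2 verbatim to every `d`; §3 adds the operator-level statement HRS-type consumers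
read: on `s`-periodic coarse data the `ℤ^d` section acts
THROUGH the periodised `(ℤ∕s)^d`-indexed matrix `Ĥ(p, c)`, whose rows sum to `1`, whose absolute row sums are bounded by the `ℤ^d`
row (so by (46)'s constant), and whose output is `(n+1)s`-periodic in the fine variable — i.e. `Ĥ` is an honest operator from
coarse torus fields to fine torus fields with `‖Ĥ‖_{∞→∞} ≤ C_∞`, WITHOUT a torus-side section object.  The identification of `Ĥ`
with a torus-side constrained minimiser is NOT here (no scalar torus section object in the tree; (A3)).

WHAT IS PROVED ([folklore]; every `d`, `n : ℕ`, `a > 0` where an inverse is involved):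
* §1 `side_smul_eq_bshift`, `blk_translate`, `mem_B_translate_iff`, `B_translate`, `sum_B_translate`, `sameBlk_translate`,
  `AX_translate`, **`Gk_translate`** (`G′(p + side•t, q + side•t) = G′(p, q)`, every `d`), **`gq_translate`**, **`kerQGQ_translate`**,
  `kerH_translate_side` (`kerH n a (p + side n • t) (y + t) = kerH n a p y` — `B5Hk165TranslZd.kerH_translate` respelled),
  **`HBZd_translate`** (`(H B(· − t))(p + side•t) = (H B)(p)` for every coarse field `B`).
* §2 `summable_kerH_images`, `summable_abs_kerH_images`, **`sum_abs_tsum_kerH_images_le`** (`Σ_c |Ĥ(p,c)| ≤ Σ′_y |H(p,y)|`),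
  `sum_abs_tsum_kerH_images_le_sup` (`d ≥ 3`: `≤ cHs(d,a)·K_d(δ_H)` = (46)'s `C_∞`), **`exists_sum_abs_tsum_kerH_images_le_all`**
  (every `d`: one `C(d,a)` for all sides, periods, sites), **`sum_tsum_kerH_images_eq_one`** (`Σ_c Ĥ(p,c) = 1`),
  `tsum_kerH_images_coarse_shift`, **`tsum_kerH_images_fine_shift`** (representative independence).
* §3 `abs_comp_siteOf_le`, **`HBZd_periodic_eq_sum_images`** (`(H (B ∘ siteOf))(p) = Σ_c Ĥ(p,c)·B(c)`),
  **`HBZd_periodic_fine_shift`** (the output is `(n+1)s`-periodic in `p`), **`abs_sum_images_mul_le`**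
  (`|Σ_c Ĥ(p,c)·B(c)| ≤ (Σ′_y |H(p,y)|)·R` for `|B| ≤ R`), `abs_sum_images_mul_le_sup` (`d ≥ 3`, constant `C_∞`),
  **`exists_abs_sum_images_mul_le_all`** (every `d`), `sum_images_mul_one` (`Ĥ·1 = 1`).
* §4 toy.

HONEST (what this is NOT).  Constants existential (as (46)); the periodised matrix is NOT identified with a torus minimiser; nothing of
the covariant `H_k` ((A3), NC-NE7b-α UNRULED).  BY-NAME EFFECT ON THE WALL: NONE.  NE7b NOT PRINTED ∕ NOT PROVED; spine PROVED 0∕9;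
rung (B)+1 on a FINITE torus — NOT infinite volume, NOT the mass gap, NOT Clay.  HONEST DEPENDENCY: continuum YM on T⁴ ⇐ BetaPertH ∧
nine spine estimates (0∕9 proved); BetaPertH ⇐ (D1) ∧ (D4) ∧ CAP+tail; G-an2-4 gates asym, D1 and NE2∕3∕4.
-/

set_option autoImplicit false

namespace Summit.QuantumFields.BalabanUV.T4Continuum.NE7b.OneShotChartTorusRowsZd

open Finset Real
open Literature.MathematicalPhysics.QuantumFieldTheory.Balaban1983to89
open B4Sect5Exhaustion (limInv eq_limInv_of_left_inverse)
open B4Sect5Proof (latticeConst latticeConst_nonneg)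
open B6QGQLower276 (X blk B mem_B side side_facts lapKer sameBlk AX Aker kerQGQ c0 c0_pos hyp56Z_Aker)
open B6QGQDecay237 (deltaU deltaU_pos)
open B5Hk103ScalarZd (Gk gq kerH toK abs_Gk_le tsum_Gk_mul_AX deltaH deltaH_pos tsum_kerH_row)
open B5Hk165L2Zd (HBZd)
open B5Hk165TranslZd (bshift sum_B_add lapKer_add_right)
open Summit.QuantumFields.BalabanUV.Beta.D1BFx.BlockColumnSupNorm (cHs cHs_nonneg)
open OneShotChartSupNorm (summable_abs_kerH_row tsum_abs_kerH_le_sup exists_tsum_abs_kerH_le_all summable_HBZd_of_bounded)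

noncomputable section

variable {d : ℕ}

/-! ## §1. Block-translation covariance on `ℤ^d`, every dimension -/

/-- The two spellings of the block-lattice translation agree: `side n • t = bshift n t` (`= (n+1)•t`). [folklore] -/
theorem side_smul_eq_bshift (n : ℕ) (t : X d) : side n • t = bshift n t := by
  unfold bshift
  rw [Nat.cast_succ]
  rfl

/-- Block labels shift by `t` under a fine translation by `side n • t`. [folklore] -/
theorem blk_translate (n : ℕ) (p t : X d) : blk n (p + side n • t) = blk n p + t := by
  funext μ
  have hs : side n ≠ 0 := ne_of_gt (side_facts n).1
  show (p + side n • t) μ / side n = p μ / side n + t μ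
  rw [Pi.add_apply, Pi.smul_apply, smul_eq_mul, mul_comm, Int.add_mul_ediv_right _ _ hs]

/-- Blocks translate: `q ∈ B n (y + t) ↔ q − side n • t ∈ B n y`. [folklore] -/
theorem mem_B_translate_iff (n : ℕ) (y t q : X d) : q ∈ B n (y + t) ↔ q - side n • t ∈ B n y := by
  have h := blk_translate n (q - side n • t) t
  rw [sub_add_cancel] at h
  rw [mem_B, mem_B, h]
  constructor
  · intro h'; exact add_right_cancel h'
  · intro h'; rw [h']

/-- `B n (y + t)` is the image of `B n y` under `q ↦ q + side n • t`. [folklore] -/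
theorem B_translate (n : ℕ) (y t : X d) : B n (y + t) = (B n y).image (fun q : X d => q + side n • t) := by
  ext q
  rw [Finset.mem_image, mem_B_translate_iff]
  constructor
  · intro h; exact ⟨q - side n • t, h, sub_add_cancel q _⟩
  · rintro ⟨q', hq', rfl⟩; rwa [add_sub_cancel_right]

/-- **BLOCK SUMS TRANSPORT**: `Σ_{q ∈ B n (y + t)} f q = Σ_{q ∈ B n y} f (q + side n • t)` (`B5Hk165TranslZd.sum_B_add`, respelled).
[folklore] -/
theorem sum_B_translate (n : ℕ) (y t : X d) (f : X d → ℝ) :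
    ∑ q ∈ B n (y + t), f q = ∑ q ∈ B n y, f (q + side n • t) := by
  rw [sum_B_add, side_smul_eq_bshift]

/-- The same-block indicator is invariant under block-lattice translations. [folklore] -/
theorem sameBlk_translate (n : ℕ) (p q t : X d) : sameBlk n (p + side n • t) (q + side n • t) = sameBlk n p q := by
  simp only [sameBlk, blk_translate, add_left_inj]

/-- The site matrix of `Δ^η + aQ′*Q′` is invariant under block-lattice translations. [folklore] -/
theorem AX_translate (n : ℕ) (a : ℝ) (p q t : X d) : AX n a (p + side n • t) (q + side n • t) = AX n a p q := by
  simp only [AX, lapKer_add_right, sameBlk_translate]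

/-- **`G′` IS BLOCK-COVARIANT IN EVERY DIMENSION**: `G′(p + side•t, q + side•t) = G′(p, q)` — the translated kernel is a bounded
left inverse of the translation-invariant site matrix on `ℤ^d`, hence equals `limInv` (`eq_limInv_of_left_inverse`; the pattern of
`GhostLeg.Gk_translate` (d = 4) ∕ OSCRF's `Gk_sigma` (every d)). [folklore] -/
theorem Gk_translate (n : ℕ) {a : ℝ} (ha : 0 < a) (t p q : X d) :
    Gk n a (p + side n • t) (q + side n • t) = Gk n a p q := by
  have hγ : (0 : ℝ) < min 2 a := lt_min two_pos ha
  have hbd : ∀ p' q' : B4Sect5Exhaustion.K d 1, |Gk n a (p'.1 + side n • t) (q'.1 + side n • t)| ≤ 2 / min 2 a :=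
    fun p' q' => by
    refine (abs_Gk_le n ha _ _).trans (mul_le_of_le_one_right (by positivity) ?_)
    rw [Real.exp_le_one_iff, neg_nonpos]
    have := deltaU_pos d ha
    positivity
  have hinv : ∀ p' r' : B4Sect5Exhaustion.K d 1, p'.1 ∈ (Set.univ : Set (X d)) → r'.1 ∈ (Set.univ : Set (X d)) →
      ∑' q' : B4Sect5Exhaustion.K d 1, Gk n a (p'.1 + side n • t) (q'.1 + side n • t) * Aker n a q' r'
        = if p' = r' then 1 else 0 := by
    intro p' r' _ _
    have h1 : ∑' q' : B4Sect5Exhaustion.K d 1, Gk n a (p'.1 + side n • t) (q'.1 + side n • t) * Aker n a q' r'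
        = ∑' w : X d, Gk n a (p'.1 + side n • t) (w + side n • t) * AX n a w r'.1 := by
      rw [← Equiv.tsum_eq (toK (d := d))]
      rfl
    have h2 : ∀ w : X d, Gk n a (p'.1 + side n • t) (w + side n • t) * AX n a w r'.1
        = Gk n a (p'.1 + side n • t) (w + side n • t) * AX n a (w + side n • t) (r'.1 + side n • t) := fun w => by
      rw [AX_translate]
    have h3 : ∑' w : X d, Gk n a (p'.1 + side n • t) (w + side n • t) * AX n a (w + side n • t) (r'.1 + side n • t)
        = ∑' w' : X d, Gk n a (p'.1 + side n • t) w' * AX n a w' (r'.1 + side n • t) :=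
      (Equiv.addRight (side n • t)).tsum_eq (fun w' => Gk n a (p'.1 + side n • t) w' * AX n a w' (r'.1 + side n • t))
    rw [h1, tsum_congr h2, h3, tsum_Gk_mul_AX n ha]
    have hiff : p'.1 + side n • t = r'.1 + side n • t ↔ p' = r' := by
      rw [add_left_inj]
      exact ⟨fun h => Prod.ext h (Subsingleton.elim _ _), fun h => by rw [h]⟩
    simp only [hiff]
  exact eq_limInv_of_left_inverse hγ (c0_pos d n ha.ne') one_pos (hyp56Z_Aker (d := d) n a)
    (D := fun p' q' : B4Sect5Exhaustion.K d 1 => Gk n a (p'.1 + side n • t) (q'.1 + side n • t)) (M := 2 / min 2 a) hbd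
    (fun p' q' h => absurd (Set.mem_univ _) h) hinv (p := (p, 0)) (s := (q, 0)) (Set.mem_univ _) (Set.mem_univ _)

/-- **`G′Q′*` IS BLOCK-COVARIANT**: `gq n a (p + side n • t) (y + t) = gq n a p y`. [folklore] -/
theorem gq_translate (n : ℕ) {a : ℝ} (ha : 0 < a) (t p y : X d) : gq n a (p + side n • t) (y + t) = gq n a p y := by
  unfold gq
  rw [sum_B_translate]
  exact Finset.sum_congr rfl fun q _ => Gk_translate n ha t p q

/-- `Q′G′Q′*` is translation-invariant on the unit lattice: `kerQGQ n a (y + t) (y′ + t) = kerQGQ n a y y′`. [folklore] -/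
theorem kerQGQ_translate (n : ℕ) {a : ℝ} (ha : 0 < a) (t y y' : X d) : kerQGQ n a (y + t) (y' + t) = kerQGQ n a y y' := by
  unfold kerQGQ
  congr 1
  rw [sum_B_translate]
  refine Finset.sum_congr rfl fun p _ => ?_
  rw [sum_B_translate]
  refine Finset.sum_congr rfl fun q _ => ?_
  exact Gk_translate n ha t p q

/-- **THE ONE-SHOT SECTION IS BLOCK-COVARIANT IN EVERY DIMENSION**: `kerH n a (p + side n • t) (y + t) = kerH n a p y` —
`B5Hk165TranslZd.kerH_translate` (pv23; node-6 uniqueness) in the `side n • t` spelling of (54) ∕ GhostLeg. [folklore] -/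
theorem kerH_translate_side (n : ℕ) {a : ℝ} (ha : 0 < a) (t p y : X d) :
    kerH n a (p + side n • t) (y + t) = kerH n a p y := by
  rw [side_smul_eq_bshift]
  exact B5Hk165TranslZd.kerH_translate n ha p y t

/-- **`H` COMMUTES WITH COARSE TRANSLATIONS** (operator form): for every coarse field `B`,
`(H (B(· − t)))(p + side n • t) = (H B)(p)`. [folklore] -/
theorem HBZd_translate (n : ℕ) {a : ℝ} (ha : 0 < a) (Bf : X d → ℝ) (t p : X d) :
    HBZd n a (fun y => Bf (y - t)) (p + side n • t) = HBZd n a Bf p := by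
  unfold HBZd
  rw [← (Equiv.addRight t).tsum_eq (fun y => Bf (y - t) * kerH n a (p + side n • t) y)]
  exact tsum_congr fun y => by simp only [Equiv.coe_addRight, add_sub_cancel_right, kerH_translate_side n ha]

/-! ## §2. The periodised rows on the coarse torus `(ℤ∕s)^d`, every dimension -/

/-- The image series of a row converges. [folklore] -/
theorem summable_kerH_images (n : ℕ) {a : ℝ} (ha : 0 < a) (s : ℕ) [NeZero s] (p w : X d) :
    Summable fun m : X d => kerH n a p (Beta.imageShift s w m) :=
  (summable_abs_kerH_row n ha p).of_abs.comp_injective (Beta.imageShift_injective s w)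

/-- … absolutely. [folklore] -/
theorem summable_abs_kerH_images (n : ℕ) {a : ℝ} (ha : 0 < a) (s : ℕ) [NeZero s] (p w : X d) :
    Summable fun m : X d => |kerH n a p (Beta.imageShift s w m)| :=
  (summable_abs_kerH_row n ha p).comp_injective (Beta.imageShift_injective s w)

/-- **THE TORUS ROWS ARE BOUNDED BY THE `ℤ^d` ROW**: for every coarse period `s`, every fine site `p`,
`Σ_{c : (ℤ∕s)^d} |Σ′_m H(p, ĉ + s·m)| ≤ Σ′_y |H(p, y)|` (method of images: `Beta.tsum_eq_sum_tsum_imageShift`). [folklore] -/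
theorem sum_abs_tsum_kerH_images_le (n : ℕ) {a : ℝ} (ha : 0 < a) (s : ℕ) [NeZero s] (p : X d) :
    ∑ c : Beta.Site d s, |∑' m : X d, kerH n a p (Beta.imageShift s (Beta.windowMap d s c) m)|
      ≤ ∑' y : X d, |kerH n a p y| := by
  rw [Beta.tsum_eq_sum_tsum_imageShift (s := s) (summable_abs_kerH_row n ha p)]
  refine Finset.sum_le_sum fun c _ => ?_
  have hs : Summable fun m : X d => ‖kerH n a p (Beta.imageShift s (Beta.windowMap d s c) m)‖ := by
    simpa only [Real.norm_eq_abs] using summable_abs_kerH_images n ha s p (Beta.windowMap d s c)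
  have h := norm_tsum_le_tsum_norm hs
  simpa only [Real.norm_eq_abs] using h

/-- **THE TORUS LIFT OF (46)'s SUP LETTER** (`d ≥ 3`): `Σ_{c : (ℤ∕s)^d} |Ĥ(p, c)| ≤ cHs(d,a)·K_d(δ_H)` for every side `n + 1`, every
coarse period `s`, every fine site `p` — the periodised one-shot kernel has torus row sums `≤ C_∞(d,a)`. [folklore] -/
theorem sum_abs_tsum_kerH_images_le_sup (hd : 3 ≤ d) (n : ℕ) {a : ℝ} (ha : 0 < a) (s : ℕ) [NeZero s] (p : X d) :
    ∑ c : Beta.Site d s, |∑' m : X d, kerH n a p (Beta.imageShift s (Beta.windowMap d s c) m)|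
      ≤ cHs d a * latticeConst d (deltaH d a) :=
  (sum_abs_tsum_kerH_images_le n ha s p).trans (tsum_abs_kerH_le_sup hd n ha p)

/-- **THE TORUS ROW LETTER IN EVERY DIMENSION**: on `ℤ^{d+1}` there is ONE `C(d,a) > 0` with `Σ_c |Ĥ(p, c)| ≤ C` for every side,
every coarse period and every fine site ((46) v1.1's `exists_tsum_abs_kerH_le_all`). [folklore] -/
theorem exists_sum_abs_tsum_kerH_images_le_all (d : ℕ) {a : ℝ} (ha : 0 < a) :
    ∃ C : ℝ, 0 < C ∧ ∀ (n : ℕ) (s : ℕ) [NeZero s] (p : X (d + 1)),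
      ∑ c : Beta.Site (d + 1) s, |∑' m : X (d + 1), kerH n a p (Beta.imageShift s (Beta.windowMap (d + 1) s c) m)| ≤ C := by
  obtain ⟨C, hC, h⟩ := exists_tsum_abs_kerH_le_all d ha
  exact ⟨C, hC, fun n s _ p => (sum_abs_tsum_kerH_images_le n ha s p).trans (h n p)⟩

/-- **THE PERIODISED ROWS SUM TO ONE**: `Σ_{c : (ℤ∕s)^d} Ĥ(p, c) = Σ′_y H(p, y) = 1` (`H·1 = 1`, `B5Hk103ScalarZd.tsum_kerH_row`).
[folklore] -/
theorem sum_tsum_kerH_images_eq_one (n : ℕ) {a : ℝ} (ha : 0 < a) (s : ℕ) [NeZero s] (p : X d) :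
    ∑ c : Beta.Site d s, ∑' m : X d, kerH n a p (Beta.imageShift s (Beta.windowMap d s c) m) = 1 := by
  rw [← Beta.tsum_eq_sum_tsum_imageShift (s := s) (summable_abs_kerH_row n ha p).of_abs]
  exact tsum_kerH_row n ha p

/-- The image series does not depend on the coarse representative: `w ↦ w + s·t′` permutes the images. [folklore] -/
theorem tsum_kerH_images_coarse_shift (n : ℕ) (a : ℝ) (s : ℕ) (p w t' : X d) :
    ∑' m : X d, kerH n a p (Beta.imageShift s (Beta.imageShift s w t') m)
      = ∑' m : X d, kerH n a p (Beta.imageShift s w m) := by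
  simp_rw [Beta.imageShift_add]
  exact (Equiv.addLeft t').tsum_eq (fun m => kerH n a p (Beta.imageShift s w m))

/-- **REPRESENTATIVE INDEPENDENCE IN THE FINE VARIABLE** (block covariance): shifting the fine site by a full fine-torus period,
`p ↦ p + side n • (s • t)`, leaves every periodised row entry unchanged. [folklore] -/
theorem tsum_kerH_images_fine_shift (n : ℕ) {a : ℝ} (ha : 0 < a) (s : ℕ) (p w t : X d) :
    ∑' m : X d, kerH n a (p + side n • ((s : ℤ) • t)) (Beta.imageShift s w m)
      = ∑' m : X d, kerH n a p (Beta.imageShift s w m) := by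
  have hre : ∀ m : X d, Beta.imageShift s w m = Beta.imageShift s w (m - t) + (s : ℤ) • t := by
    intro m; funext i
    simp only [Beta.imageShift_apply, Pi.add_apply, Pi.sub_apply, Pi.smul_apply, smul_eq_mul]
    ring
  calc ∑' m : X d, kerH n a (p + side n • ((s : ℤ) • t)) (Beta.imageShift s w m)
      = ∑' m : X d, kerH n a p (Beta.imageShift s w (m - t)) := by
        refine tsum_congr fun m => ?_
        rw [hre m, kerH_translate_side n ha]
    _ = ∑' m : X d, kerH n a p (Beta.imageShift s w m) :=
        (Equiv.subRight t).tsum_eq (fun m => kerH n a p (Beta.imageShift s w m))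

/-! ## §3. On periodic coarse data the section IS the periodised torus matrix -/

/-- A coarse torus field lifted periodically to `ℤ^d` is bounded by the sum of its absolute values. [folklore] -/
theorem abs_comp_siteOf_le (s : ℕ) [NeZero s] (Bc : Beta.Site d s → ℝ) (y : X d) :
    |Bc (Beta.siteOf d s y)| ≤ ∑ c : Beta.Site d s, |Bc c| :=
  Finset.single_le_sum (f := fun c => |Bc c|) (fun c _ => abs_nonneg (Bc c)) (Finset.mem_univ _)

/-- **ON `s`-PERIODIC COARSE DATA THE SECTION ACTS THROUGH THE PERIODISED MATRIX**: for every `B : (ℤ∕s)^d → ℝ` and every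
fine site `p`, `(H (B ∘ siteOf))(p) = Σ_{c : (ℤ∕s)^d} Ĥ(p, c)·B(c)` with `Ĥ(p, c) = Σ′_m H(p, ĉ + s·m)` — the images identity at the
level of the operator (`tsum_eq_sum_tsum_imageShift`, `siteOf_imageShift`, `siteOf_windowMap`). [folklore] -/
theorem HBZd_periodic_eq_sum_images (n : ℕ) {a : ℝ} (ha : 0 < a) (s : ℕ) [NeZero s] (Bc : Beta.Site d s → ℝ) (p : X d) :
    HBZd n a (fun y => Bc (Beta.siteOf d s y)) p
      = ∑ c : Beta.Site d s, (∑' m : X d, kerH n a p (Beta.imageShift s (Beta.windowMap d s c) m)) * Bc c := by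
  have hsum : Summable fun y : X d => Bc (Beta.siteOf d s y) * kerH n a p y :=
    summable_HBZd_of_bounded n ha (fun y => abs_comp_siteOf_le s Bc y) p
  unfold HBZd
  rw [Beta.tsum_eq_sum_tsum_imageShift (s := s) hsum]
  refine Finset.sum_congr rfl fun c _ => ?_
  have hc : ∀ m : X d, Bc (Beta.siteOf d s (Beta.imageShift s (Beta.windowMap d s c) m))
      * kerH n a p (Beta.imageShift s (Beta.windowMap d s c) m)
      = Bc c * kerH n a p (Beta.imageShift s (Beta.windowMap d s c) m) := fun m => by
    rw [Beta.siteOf_imageShift, Beta.siteOf_windowMap]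
  rw [tsum_congr hc, tsum_mul_left, mul_comm]

/-- The torus site of a full coarse period vanishes: `siteOf (s • t) = 0`. [folklore] -/
theorem siteOf_period_smul (s : ℕ) (t : X d) : Beta.siteOf d s ((s : ℤ) • t) = 0 := by
  funext i
  show (((s : ℤ) • t) i : ZMod s) = 0
  rw [Pi.smul_apply, smul_eq_mul, Int.cast_mul, Int.cast_natCast, ZMod.natCast_self, zero_mul]

/-- **THE OUTPUT IS PERIODIC WITH THE FINE TORUS PERIOD**: `(H (B ∘ siteOf))(p + side n • (s • t)) = (H (B ∘ siteOf))(p)` — with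
`HBZd_periodic_eq_sum_images`, the periodised matrix is an honest operator from `(ℤ∕s)^d`-fields to `(ℤ∕(n+1)s)^d`-fields.
[folklore] -/
theorem HBZd_periodic_fine_shift (n : ℕ) {a : ℝ} (ha : 0 < a) (s : ℕ) (Bc : Beta.Site d s → ℝ) (p t : X d) :
    HBZd n a (fun y => Bc (Beta.siteOf d s y)) (p + side n • ((s : ℤ) • t))
      = HBZd n a (fun y => Bc (Beta.siteOf d s y)) p := by
  have hper : (fun y : X d => Bc (Beta.siteOf d s (y - (s : ℤ) • t))) = fun y => Bc (Beta.siteOf d s y) := by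
    funext y
    rw [Beta.siteOf_sub, siteOf_period_smul, sub_zero]
  rw [← HBZd_translate n ha (fun y => Bc (Beta.siteOf d s y)) ((s : ℤ) • t) p, hper]

/-- **THE PERIODISED MATRIX IS A SUP-CONTRACTION UP TO THE `ℤ^d` ROW**: `|Σ_c Ĥ(p, c)·B(c)| ≤ (Σ′_y |H(p, y)|)·R` whenever
`|B(c)| ≤ R` for all `c`. [folklore] -/
theorem abs_sum_images_mul_le (n : ℕ) {a : ℝ} (ha : 0 < a) (s : ℕ) [NeZero s] {Bc : Beta.Site d s → ℝ} {R : ℝ}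
    (hB : ∀ c, |Bc c| ≤ R) (p : X d) :
    |∑ c : Beta.Site d s, (∑' m : X d, kerH n a p (Beta.imageShift s (Beta.windowMap d s c) m)) * Bc c|
      ≤ (∑' y : X d, |kerH n a p y|) * R := by
  have hR : 0 ≤ R := (abs_nonneg _).trans (hB 0)
  calc |∑ c : Beta.Site d s, (∑' m : X d, kerH n a p (Beta.imageShift s (Beta.windowMap d s c) m)) * Bc c|
      ≤ ∑ c : Beta.Site d s, |(∑' m : X d, kerH n a p (Beta.imageShift s (Beta.windowMap d s c) m)) * Bc c| :=
        Finset.abs_sum_le_sum_abs _ _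
    _ ≤ ∑ c : Beta.Site d s, |∑' m : X d, kerH n a p (Beta.imageShift s (Beta.windowMap d s c) m)| * R := by
        refine Finset.sum_le_sum fun c _ => ?_
        rw [abs_mul]
        exact mul_le_mul_of_nonneg_left (hB c) (abs_nonneg _)
    _ = (∑ c : Beta.Site d s, |∑' m : X d, kerH n a p (Beta.imageShift s (Beta.windowMap d s c) m)|) * R :=
        (Finset.sum_mul _ _ _).symm
    _ ≤ (∑' y : X d, |kerH n a p y|) * R :=
        mul_le_mul_of_nonneg_right (sum_abs_tsum_kerH_images_le n ha s p) hR

/-- **`‖Ĥ‖_{∞→∞} ≤ C_∞(d,a)`** (`d ≥ 3`): `|Σ_c Ĥ(p, c)·B(c)| ≤ cHs(d,a)·K_d(δ_H)·R` for `|B| ≤ R`, every side, every coarse period,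
every fine site — (46)'s sup letter on the torus. [folklore] -/
theorem abs_sum_images_mul_le_sup (hd : 3 ≤ d) (n : ℕ) {a : ℝ} (ha : 0 < a) (s : ℕ) [NeZero s] {Bc : Beta.Site d s → ℝ}
    {R : ℝ} (hB : ∀ c, |Bc c| ≤ R) (p : X d) :
    |∑ c : Beta.Site d s, (∑' m : X d, kerH n a p (Beta.imageShift s (Beta.windowMap d s c) m)) * Bc c|
      ≤ cHs d a * latticeConst d (deltaH d a) * R :=
  (abs_sum_images_mul_le n ha s hB p).trans
    (mul_le_mul_of_nonneg_right (tsum_abs_kerH_le_sup hd n ha p) ((abs_nonneg _).trans (hB 0)))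

/-- **`‖Ĥ‖_{∞→∞} ≤ C(d,a)` IN EVERY DIMENSION**: on `ℤ^{d+1}` one constant serves every side, every coarse period, every datum and
every fine site. [folklore] -/
theorem exists_abs_sum_images_mul_le_all (d : ℕ) {a : ℝ} (ha : 0 < a) :
    ∃ C : ℝ, 0 < C ∧ ∀ (n : ℕ) (s : ℕ) [NeZero s] (Bc : Beta.Site (d + 1) s → ℝ) (R : ℝ), (∀ c, |Bc c| ≤ R) →
      ∀ p : X (d + 1),
        |∑ c : Beta.Site (d + 1) s, (∑' m : X (d + 1), kerH n a p (Beta.imageShift s (Beta.windowMap (d + 1) s c) m)) * Bc c|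
          ≤ C * R := by
  obtain ⟨C, hC, h⟩ := exists_tsum_abs_kerH_le_all d ha
  refine ⟨C, hC, fun n s _ Bc R hB p => (abs_sum_images_mul_le n ha s hB p).trans ?_⟩
  exact mul_le_mul_of_nonneg_right (h n p) ((abs_nonneg _).trans (hB 0))

/-- **`Ĥ·1 = 1`**: the periodised matrix reproduces coarse constants. [folklore] -/
theorem sum_images_mul_one (n : ℕ) {a : ℝ} (ha : 0 < a) (s : ℕ) [NeZero s] (p : X d) :
    ∑ c : Beta.Site d s, (∑' m : X d, kerH n a p (Beta.imageShift s (Beta.windowMap d s c) m)) * (1 : ℝ) = 1 := by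
  simp_rw [mul_one]
  exact sum_tsum_kerH_images_eq_one n ha s p

/-! ## §4. Toy -/

/-- Toy: the image re-indexing used in §2 — `w + s·m = (w + s(m − t)) + s·t` in one coordinate (`s = 5`, `w = 2`, `m = 7`, `t = 3`). -/
example : (2 : ℤ) + 5 * 7 = (2 + 5 * (7 - 3)) + 5 * 3 := by norm_num

end

end Summit.QuantumFields.BalabanUV.T4Continuum.NE7b.OneShotChartTorusRowsZd
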